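import Summits.FinalStateConjecture.FinalStateConjecture.Theses.StarvedNecks
import Summits.FinalStateConjecture.FinalStateConjecture.Theorems.HonestFixedRadiusSettling.Negative.KillShape
import Summits.FinalStateConjecture.FinalStateConjecture.Theorems.ChannelsResolveTameDevelopmentsR.Negative.SubMinkowskiSettledT2
import Summits.FinalStateConjecture.FinalStateConjecture.Theorems.ChannelsResolveTameDevelopmentsR.Negative.SubMinkowskiPastCut
import Literature.Geometry.Lorentzian.TameGenericityDiagonal
import Literature.Geometry.Lorentzian.TrivialDataAdmissible
import HarnessLib

/-!
# `HonestFixedRadiusSettlingT` — load-bearing census of the THREE EDITS on the flat model class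
# (negative-side support for crux `stmt-FinalStateConjecture-17575`, route StarvedNecks; cdisprove gen 1)

`T = Theses.StarvedNecks.HonestFixedRadiusSettlingT` is the rev-1 crux `HonestFixedRadiusSettling`
(13550; its negative battery is `Theorems/HonestFixedRadiusSettling/Negative/*`) with three edits:
(1) TAME Christodoulou genericity (one fixed sole end, `wDist`-continuity and immersion at `c = 0`);
(2) the rays clause `RaysStayInClosure 𝒟 O`; (3) pairwise distinct hole velocities. This file records what
the tree can CERTIFY about the edits.

* §0 READ-BACK (Set-valued, reusing `honestCoreSet`/`honestFarSet` of the rev-1 battery): `velocitySet`,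
  `settledT D` (the developments at which the universal conjunct of `P_T` holds), and
  `T_iff : T ↔ ∀ Σ, IsTameChristodoulouGeneric (admissibleVacuumData Σ) (MGHD ∧ ∀ MGHD ∈ settledT) 1`
  (`Iff.rfl`).
* §1 EDIT (1). `isTameChristodoulouGeneric_admissibleT_zero` (tame codimension `0` is free: the `1` is the
  content); `not_isImmersedAtZero_of_eventuallyEq` — a family whose scalar components are eventually
  constant in `c` at every point (a pure far-field "broom", the rev-1 burial beyond a receding radius) is NOT
  immersed at `0`: every `T`-witness curve carries a non-zero first-order LOCAL perturbation direction.
* §2 THE FLAT MODEL CLASS (the only developments of an admissible datum the tree certifies: the open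
  sub-developments `η|_U` of the trivial datum, `SubMinkowski.subDev`). `subDecompK k` (the honest `N = 0`
  decomposition in every `Cᵏ`), and the census
  `subDev_mem_settledT_iff : η|_U ∈ settledT ↔ {x⁰ ≥ 0} ⊆ U ↔ complete 𝓘⁺`: on the certifiable class ALL
  of `T`'s decomposition clauses — `k = 4`, `HonestCore`, `HonestFar`, `O = exteriorOf`, the rays clause
  (edit 2), distinct velocities (edit 3) — are IDLE relative to complete `𝓘⁺`; `pastCutDev_mem_settledT`
  (a NON-maximal development T-settles); `truncated_not_mem_settledT` and
  `trivialData_exceptional_withoutIsMaximalT` (the guard `IsMaximal →` is load-bearing for `T` exactly as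
  for 13550, `MaximalityLoadBearing`); `curve_obligation_of_TWithoutIsMaximal` (what the unguarded statement
  would demand at the trivial datum: a tame immersed admissible curve all of whose other members have ONLY
  complete-`𝓘⁺` developments).
* §3 EDIT (3). `mem_velocitySet_of_N_le_one`: vacuous for `N ≤ 1`; for `N ≥ 2` it excludes exactly the
  comoving / parabolic pairs (`ComovingPairWitness` of the NecksCertify repair) — codimension-1 physics.

Nothing here refutes `T`; no MGHD of a non-trivial datum is constructible, so `P_T d` is undecidable in the
tree for every single admissible `d` (workfile `Cruxes/HonestFixedRadiusSettlingT/Disproof.lean` §5 for the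
paper census: the `k = 4` far-field trains, brooms + kicks, rigidity of honest flat charts, hidden second
infinity). All results proved, standard axioms; no named facts.

References: Christodoulou, CQG 16 (1999) A23, p. A24, pp. A26–A27; Dafermos–Luk arXiv:1710.01722, Conj. 1;
O'Neill 1983, Ch. 14, p. 402; Ringström 2009, Def. 16.5.
-/

noncomputable section

open Bundle Set Function Filter TopologicalSpace Topology
open scoped Manifold ContDiff Topology ENNReal

namespace Summit.FinalStateConjecture.FinalStateConjecture.Theorems.HonestFixedRadiusSettlingT.Negative.FlatClass

open Literature.Geometry.Lorentzian
open Summit.FinalStateConjecture.FinalStateConjecture.Theses.StarvedNecks (HonestFixedRadiusSettlingT)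
open Summit.FinalStateConjecture.FinalStateConjecture.Theorems.HonestFixedRadiusSettling.Negative
  (honestCoreSet honestFarSet)

/-! ### §0 Read-back of the crux (Set-valued) -/

/-- EDIT (3): the decompositions whose holes have pairwise distinct asymptotic four-velocities `Λᵢ e₀`.
[cite: DafermosLuk2017, Conjecture 1] -/
def velocitySet (𝓢 : Spacetime.{0} 4) (O : Set 𝓢.carrier) (k : ℕ) : Set (FinalStateDecomposition 𝓢 O k) :=
  {d | ∀ i j : Fin d.N, i ≠ j →
    ((d.motion i).1 : E4 ≃L[ℝ] E4) (E4.basisVector 0) ≠ ((d.motion j).1 : E4 ≃L[ℝ] E4) (E4.basisVector 0)}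

section Pointwise

variable {X : Type} [TopologicalSpace X] [ChartedSpace E3 X] [IsManifold (𝓡 3) ∞ X] [ConnectedSpace X]

/-- The vacuum Cauchy developments of `D` at which the universal conjunct of `P_T` holds: complete `𝓘⁺`
and an honest fixed-radius `C⁴` decomposition of the self-determined exterior with the rays clause
(EDIT 2), `HonestCore`, `HonestFar` and distinct velocities (EDIT 3). [cite: DafermosLuk2017, Conjecture 1] -/
def settledT (D : InitialDataSet (𝓡 3) X) : Set (VacuumCauchyDevelopment D) :=
  {𝒟 | HasCompleteNullInfinity 𝒟.toCauchyDevelopment ∧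
    ∃ (O : Set 𝒟.carrier) (d : FinalStateDecomposition 𝒟.toSpacetime O 4) (R₀ : ℝ),
      O = exteriorOf 𝒟.toCauchyDevelopment d.charted ∧
        RaysStayInClosure 𝒟.toCauchyDevelopment O ∧
          d ∈ honestCoreSet 𝒟.toSpacetime O 4 R₀ ∧ d ∈ honestFarSet 𝒟.toSpacetime O 4 R₀ ∧
            d ∈ velocitySet 𝒟.toSpacetime O 4}

end Pointwise

/-- **Read-back.** The crux is, for every `Σ`, TAME Christodoulou genericity with codimension `1` of
"an MGHD exists and every MGHD is in `settledT`" — by `Iff.rfl` (the let-bound clauses zeta-reduce to the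
sets above). [cite: Christodoulou1999, p. A24] -/
theorem T_iff :
    HonestFixedRadiusSettlingT ↔ ∀ (X : Type) [TopologicalSpace X] [ChartedSpace E3 X]
      [IsManifold (𝓡 3) ∞ X] [T2Space X] [SecondCountableTopology X] [ConnectedSpace X],
      InitialDataSet.IsTameChristodoulouGeneric (admissibleVacuumData X)
        (fun D ↦ (∃ 𝒟 : VacuumCauchyDevelopment D, 𝒟.IsMaximal) ∧
          ∀ 𝒟 : VacuumCauchyDevelopment D, 𝒟.IsMaximal → 𝒟 ∈ settledT D) 1 :=
  Iff.rfl

/-! ### §1 Edit (1): tame codimension `0` is free; immersion excludes receding families -/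

section Genericity

variable {Y : Type*} [TopologicalSpace Y] [ChartedSpace E3 Y] [IsManifold (𝓡 3) ∞ Y]

/-- TAME codimension `0` is free for every property on a class all of whose members have a sole strongly
asymptotically flat end: the constant family is tame (`isTameDataFamily_const`); immersion, injectivity and
"only at `0`" are vacuous on the one-point parameter space `ℝ⁰`. So the `1` of the crux is its whole
content. [cite: Christodoulou1999, p. A24] -/
theorem isTameChristodoulouGeneric_zero_of_soleEnd {𝓓 : Set (InitialDataSet (𝓡 3) Y)}
    (h𝓓 : ∀ d ∈ 𝓓, ∃ e : AFEnd Y, e.IsSoleEnd ∧ ∃ M : ℝ, e.IsStronglyAsymptoticallyFlatDR d M)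
    (P : InitialDataSet (𝓡 3) Y → Prop) : InitialDataSet.IsTameChristodoulouGeneric 𝓓 P 0 := by
  intro d hd
  obtain ⟨e, hsole, M, hM⟩ := h𝓓 d hd.1
  refine ⟨e, fun _ ↦ d, InitialDataSet.isTameDataFamily_const hsole 0 hM, ?_, rfl, ?_, fun _ ↦ hd.1, ?_⟩
  · intro v hv
    exact absurd (Subsingleton.elim v 0) hv
  · intro a b _
    exact Subsingleton.elim a b
  · intro c hc
    exact absurd (Subsingleton.elim c 0) hc

/-- **Immersion at `0` excludes receding families.** A family whose scalar components `c ↦ h_c(x)(u,w)`,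
`c ↦ k_c(x)(u,w)` are, at EVERY point and pair of vectors, eventually equal to their value at `c = 0` as
`c → 0` — e.g. a family agreeing with its base datum on every compact set for `‖c‖` small: a pure far-field
"broom" cleaning the datum beyond radius `1/‖c‖`, or the exact-Kerr burial beyond a receding radius — is
NOT immersed at `0` (all parameter derivatives at `0` vanish, `Filter.EventuallyEq.fderiv_eq`). Hence every
witness curve of the crux carries a non-zero first-order LOCAL perturbation direction `dF/dc(0)`: brooms
must come with kicks. [cite: Christodoulou1999, p. A24] -/
theorem not_isImmersedAtZero_of_eventuallyEq {m : ℕ} (hm : m ≠ 0)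
    {F : EuclideanSpace ℝ (Fin m) → InitialDataSet (𝓡 3) Y}
    (hh : ∀ (x : Y) (u w : TangentSpace (𝓡 3) x),
      (fun c ↦ (F c).h.inner x u w) =ᶠ[𝓝 0] fun _ ↦ (F 0).h.inner x u w)
    (hk : ∀ (x : Y) (u w : TangentSpace (𝓡 3) x),
      (fun c ↦ (F c).k x u w) =ᶠ[𝓝 0] fun _ ↦ (F 0).k x u w) :
    ¬ InitialDataSet.IsImmersedAtZero m F := by
  intro himm
  obtain ⟨x, u, w, huw⟩ := himm (EuclideanSpace.single ⟨0, Nat.pos_of_ne_zero hm⟩ 1) (by simp)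
  rcases huw with huw | huw
  · apply huw
    rw [(hh x u w).fderiv_eq]
    simp
  · apply huw
    rw [(hk x u w).fderiv_eq]
    simp

end Genericity

/-- The crux's clause at TAME codimension `0` holds outright, for every `Σ` (admissible data have a sole
strongly asymptotically flat end, `exists_isSoleEnd_of_mem_admissibleVacuumData`).
[cite: Christodoulou1999, p. A24] -/
theorem isTameChristodoulouGeneric_admissibleT_zero (X : Type) [TopologicalSpace X] [ChartedSpace E3 X]
    [IsManifold (𝓡 3) ∞ X] [T2Space X] [SecondCountableTopology X] [ConnectedSpace X] :
    InitialDataSet.IsTameChristodoulouGeneric (admissibleVacuumData X)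
      (fun D ↦ (∃ 𝒟 : VacuumCauchyDevelopment D, 𝒟.IsMaximal) ∧
        ∀ 𝒟 : VacuumCauchyDevelopment D, 𝒟.IsMaximal → 𝒟 ∈ settledT D) 0 :=
  isTameChristodoulouGeneric_zero_of_soleEnd (fun _ hd ↦ exists_isSoleEnd_of_mem_admissibleVacuumData hd) _

/-! ### §2 The flat model class: `η|_U ∈ settledT ↔ {x⁰ ≥ 0} ⊆ U ↔ complete 𝓘⁺` -/

section FlatClass

open Summit.FinalStateConjecture.FinalStateConjecture.Theorems.ChannelsResolveTameDevelopmentsR.SubMinkowski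
open Literature.Geometry.Lorentzian.Minkowski

variable {U : Opens E4} {hU : IsConnected (U : Set E4)} {hsl : ∀ y : slice, sliceEmbed y ∈ U}
  {hC : (subMetric U).IsCauchyHypersurface (subOrientation U)
    (range (vacuumCauchyDevelopment.embedOpens U hsl))}

/-- The honest `N = 0` decomposition IN `Cᵏ` (every `k`; the crux asks `k = 4`) of the future half-space
`O = {x⁰ ≥ 0}` of `η|_U`, when `{x⁰ ≥ 0} ⊆ U`: the battery's `subDecomp` with the regularity made a
parameter (the inclusion chart has deviation `0`, so `k` is idle). [cite: ChristodoulouKlainerman1993, Thm. 1.0.2] -/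
def subDecompK (k : ℕ) (hfut : {x : E4 | 0 ≤ x 0} ⊆ (U : Set E4)) :
    FinalStateDecomposition (subDev U hU hsl hC).toSpacetime (futureSet U) k where
  N := 0
  mass := Fin.elim0
  spin := Fin.elim0
  mass_pos i := i.elim0
  abs_spin_le_mass i := i.elim0
  motion := Fin.elim0
  τ₀ := 1
  chart i := i.elim0
  isLateChart i := i.elim0
  tendsto_truncDeviationCk i := i.elim0
  exists_pairwise_disjoint _ := ⟨0, fun i ↦ i.elim0⟩
  excision := Fin.elim0
  tendsto_excision_div i := i.elim0
  flatDomain := flatDom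
  setOf_lt_excision_subset_flatDomain x hx := (zero_lt_one.trans hx.1 : (0 : ℝ) < x 0)
  flatChart := Opens.inclusion (flatDom_le hfut)
  isLateChart_flat := by
    refine ⟨contMDiff_inclusion (flatDom_le hfut), ?_, ?_⟩
    · have hlate : IsOpen ((Minkowski.backgroundOn flatDom).lateRegion 1) :=
        isOpen_lt continuous_const ((PiLp.continuous_apply 2 _ 0).comp continuous_subtype_val)
      exact (Opens.isOpenEmbedding_of_le (flatDom_le hfut)).comp (IsOpen.isOpenEmbedding_subtypeVal hlate)
    · rintro _ ⟨y, hy, rfl⟩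
      show (0 : ℝ) ≤ (y : E4) 0
      exact zero_le_one.trans (le_of_lt hy)
  tendsto_deviationCk_flat := by
    have h : ∀ τ, (subDev U hU hsl hC).toSpacetime.deviationCk (Minkowski.backgroundOn flatDom)
        (Opens.inclusion (flatDom_le hfut)) k τ = 0 := fun τ ↦ by
      rw [Spacetime.deviationCk, deviationExtend_inclusion hfut, supCkENorm_zero]
    exact tendsto_const_nhds.congr fun τ ↦ (h τ).symm
  diff_subset_causalPast := by
    intro x hx
    change U at x
    have hx0 : (0 : ℝ) ≤ (x : E4) 0 := hx.1
    have hxle : (x : E4) 0 ≤ 1 := by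
      refine not_lt.mp fun hlt ↦ hx.2 (Or.inr ?_)
      exact ⟨⟨(x : E4), show (0 : ℝ) < (x : E4) 0 from zero_lt_one.trans hlt⟩, hlt, rfl⟩
    refine LorentzianMetric.causalFuture_mono ?_ (mem_causalPast_slab_of_time_le hfut hx0 hxle)
    intro z hz
    change U at z
    have hz' : (z : E4) 0 = 1 := hz
    exact Or.inr ⟨⟨(z : E4), show (0 : ℝ) < (z : E4) 0 by rw [hz']; exact zero_lt_one⟩, hz', rfl⟩

/-- `subDecompK` has no hole. [cite: ChristodoulouKlainerman1993, Thm. 1.0.2] -/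
theorem subDecompK_N (k : ℕ) (hfut : {x : E4 | 0 ≤ x 0} ⊆ (U : Set E4)) :
    (subDecompK (hU := hU) (hsl := hsl) (hC := hC) k hfut).N = 0 := rfl

/-- The charted late region of `subDecompK` is `{x⁰ > 1}`. [cite: ChristodoulouKlainerman1993, Thm. 1.0.2] -/
theorem charted_subDecompK (k : ℕ) (hfut : {x : E4 | 0 ≤ x 0} ⊆ (U : Set E4)) :
    (subDecompK (hU := hU) (hsl := hsl) (hC := hC) k hfut).charted = {z : U | 1 < (z : E4) 0} := by
  refine Set.ext fun (z : U) ↦ ?_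
  rw [FinalStateDecomposition.charted, FinalStateDecomposition.radiationZone]
  constructor
  · rintro (⟨y, hy, rfl⟩ | ⟨_, ⟨i, rfl⟩, _⟩)
    · exact hy
    · exact i.elim0
  · intro hz
    exact Or.inl ⟨⟨(z : E4), show (0 : ℝ) < (z : E4) 0 from zero_lt_one.trans hz⟩, hz, rfl⟩

/-- `O = {x⁰ ≥ 0}` is the self-determined exterior `J⁺(ι ℝ³) ∩ I⁻(charted)` of `subDecompK`.
[cite: DafermosLuk2017, Conjecture 1] -/
theorem futureSet_eq_exteriorOf_subDecompK (k : ℕ) (hfut : {x : E4 | 0 ≤ x 0} ⊆ (U : Set E4)) :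
    futureSet U = exteriorOf (subDev U hU hsl hC).toCauchyDevelopment
      (subDecompK (hU := hU) (hsl := hsl) (hC := hC) k hfut).charted := by
  rw [charted_subDecompK, ← charted_subDecomp hfut]
  exact futureSet_eq_exteriorOf hfut

/-- `HonestCore` holds for `subDecompK` (every `R₀`): C1–C3 are vacuous and the inclusion pushes `∂₀`
forward to `∂ₜ|_U`, which is future-directed (`OpensChart.mfderiv_inclusion_apply`).
[cite: arXiv08110354, §5.1] -/
theorem subDecompK_mem_honestCoreSet (k : ℕ) (hfut : {x : E4 | 0 ≤ x 0} ⊆ (U : Set E4)) (R₀ : ℝ) :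
    subDecompK k hfut ∈ honestCoreSet (subDev U hU hsl hC).toSpacetime (futureSet U) k R₀ := by
  refine ⟨fun i ↦ i.elim0, fun i ↦ i.elim0, fun i ↦ i.elim0, fun y _ ↦ ?_⟩
  change (subDev U hU hsl hC).timeOrientation.IsFutureDirected
    (mfderiv 𝓘(ℝ, E4) (𝓡 4) (Opens.inclusion (flatDom_le hfut)) y (E4.basisVector 0))
  rw [show mfderiv 𝓘(ℝ, E4) (𝓡 4) (Opens.inclusion (flatDom_le hfut)) y (E4.basisVector 0) =
      E4.basisVector 0 from OpensChart.mfderiv_inclusion_apply (flatDom_le hfut) y (E4.basisVector 0)]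
  exact (subDev U hU hsl hC).timeOrientation.isFutureDirected_vectorField _

/-- `HonestFar` holds for `subDecompK` (every `R₀`): a flat-late point `1 < x⁰ < τ₂` lies below the slab
`{x⁰ = τ₂}` within `U` (`mem_causalPast_slab_of_time_le`), the late half-spaces `{τ' ≤ x⁰}` are closed in
`U`, and F3 is vacuous. [cite: ONeill1983, Ch. 14  p. 402] -/
theorem subDecompK_mem_honestFarSet (k : ℕ) (hfut : {x : E4 | 0 ≤ x 0} ⊆ (U : Set E4)) (R₀ : ℝ) :
    subDecompK k hfut ∈ honestFarSet (subDev U hU hsl hC).toSpacetime (futureSet U) k R₀ := by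
  refine ⟨?_, ?_, fun i ↦ i.elim0⟩
  · rintro τ₂ (hτ₂ : (1 : ℝ) < τ₂) _ ⟨y, ⟨hy₁, hy₂⟩, rfl⟩
    have hy₁' : (1 : ℝ) < (y : E4) 0 := hy₁
    have hy₂' : (y : E4) 0 < τ₂ := hy₂
    have hx0 : (0 : ℝ) ≤ ((Opens.inclusion (flatDom_le hfut) y : U) : E4) 0 :=
      zero_le_one.trans (le_of_lt hy₁')
    have hxle : ((Opens.inclusion (flatDom_le hfut) y : U) : E4) 0 ≤ τ₂ := le_of_lt hy₂'
    refine LorentzianMetric.causalFuture_mono ?_ (mem_causalPast_slab_of_time_le hfut hx0 hxle)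
    intro z hz
    change U at z
    have hz' : (z : E4) 0 = τ₂ := hz
    exact ⟨⟨(z : E4), show (0 : ℝ) < (z : E4) 0 by rw [hz']; exact zero_lt_one.trans hτ₂⟩, hz', rfl⟩
  · intro τ' hτ'
    have hτ'' : (1 : ℝ) < τ' := hτ'
    have himg : (Opens.inclusion (flatDom_le hfut) '' {y : flatDom | τ' ≤ (y : E4) 0} : Set U) =
        {z : U | τ' ≤ (z : E4) 0} := by
      refine Set.ext fun (z : U) ↦ ⟨?_, fun hz ↦ ?_⟩
      · rintro ⟨y, hy, rfl⟩
        exact hy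
      · exact ⟨⟨(z : E4), show (0 : ℝ) < (z : E4) 0 from
          (zero_lt_one.trans hτ'').trans_le hz⟩, hz, rfl⟩
    have hcl : IsClosed ({z : U | τ' ≤ (z : E4) 0} : Set U) :=
      isClosed_le continuous_const ((PiLp.continuous_apply 2 _ 0).comp continuous_subtype_val)
    refine (closure_mono (Set.image_mono fun y hy ↦ hy.1)).trans ?_
    change closure (Opens.inclusion (flatDom_le hfut) '' {y : flatDom | τ' ≤ (y : E4) 0} : Set U) ⊆
      Opens.inclusion (flatDom_le hfut) '' {y : flatDom | τ' ≤ (y : E4) 0}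
    rw [himg]
    exact hcl.closure_subset

/-- EDIT (3) is vacuous for `subDecompK` (`N = 0`). [cite: DafermosLuk2017, Conjecture 1] -/
theorem subDecompK_mem_velocitySet (k : ℕ) (hfut : {x : E4 | 0 ≤ x 0} ⊆ (U : Set E4)) :
    subDecompK (hU := hU) (hsl := hsl) (hC := hC) k hfut ∈
      velocitySet (subDev U hU hsl hC).toSpacetime (futureSet U) k := fun i ↦ i.elim0

/-- **If `{x⁰ ≥ 0} ⊆ U` then `η|_U` T-SETTLES**: complete `𝓘⁺` (`hasCompleteNullInfinity_of_future_subset`)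
and the honest `C⁴` decomposition `subDecompK 4` of `O = {x⁰ ≥ 0} = exteriorOf` with the rays clause
(`raysStayInClosure_futureSet`: EDIT (2) holds on the WHOLE flat class, complete or not), `HonestCore`,
`HonestFar` (any `R₀`; here `0`) and (vacuously) distinct velocities. [cite: ChristodoulouKlainerman1993, Thm. 1.0.2] -/
theorem subDev_mem_settledT_of_future_subset (hfut : {x : E4 | 0 ≤ x 0} ⊆ (U : Set E4)) :
    subDev U hU hsl hC ∈ settledT trivialData :=
  ⟨hasCompleteNullInfinity_of_future_subset hfut, futureSet U, subDecompK 4 hfut, 0,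
    futureSet_eq_exteriorOf_subDecompK 4 hfut, raysStayInClosure_futureSet, subDecompK_mem_honestCoreSet 4 hfut 0,
    subDecompK_mem_honestFarSet 4 hfut 0, subDecompK_mem_velocitySet 4 hfut⟩

/-- **CENSUS OF `P_T`'S UNIVERSAL CONJUNCT ON THE FLAT CLASS.** `η|_U ∈ settledT ↔ {x⁰ ≥ 0} ⊆ U`:
(→) by the completeness clause alone (`hasCompleteNullInfinity_iff_future_subset`); (←)
`subDev_mem_settledT_of_future_subset`. [cite: Christodoulou1999, pp. A26–A27] -/
theorem subDev_mem_settledT_iff_future_subset :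
    subDev U hU hsl hC ∈ settledT trivialData ↔ {x : E4 | 0 ≤ x 0} ⊆ (U : Set E4) :=
  ⟨fun h ↦ hasCompleteNullInfinity_iff_future_subset.1 h.1, subDev_mem_settledT_of_future_subset⟩

/-- **On the certifiable class ALL of `T`'s decomposition clauses are idle relative to complete `𝓘⁺`:**
`η|_U ∈ settledT ↔ HasCompleteNullInfinity (η|_U)`. Regularity `k = 4`, `HonestCore`, `HonestFar`,
`O = exteriorOf`, the rays clause (EDIT 2) and distinct velocities (EDIT 3) carry no independent load at
`N = 0`: the three edits change nothing in the flat-class picture of the rev-1 crux (compare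
`SubMinkowskiSettledT2.settlesT2_of_hasCompleteNullInfinity` for the summit's clause set).
[cite: Christodoulou1999, pp. A26–A27] -/
theorem subDev_mem_settledT_iff_hasCompleteNullInfinity :
    subDev U hU hsl hC ∈ settledT trivialData ↔ HasCompleteNullInfinity (subDev U hU hsl hC).toCauchyDevelopment :=
  subDev_mem_settledT_iff_future_subset.trans hasCompleteNullInfinity_iff_future_subset.symm

end FlatClass

section Consequences

open Summit.FinalStateConjecture.FinalStateConjecture.Theorems.ChannelsResolveTameDevelopmentsR.SubMinkowski

/-- **A NON-MAXIMAL development T-settles**: the past cut `{x⁰ > −1}` of Minkowski space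
(`pastCutDev_not_isMaximal`). [cite: Ringstrom2009, Def. 16.5] -/
theorem pastCutDev_mem_settledT : pastCutDev ∈ settledT trivialData :=
  subDev_mem_settledT_of_future_subset future_subset_pastCut

/-- Non-vacuity of "`P_T` without `IsMaximal`, guarded by complete `𝓘⁺`": some development of the trivial
datum is T-settled and not maximal. [cite: Ringstrom2009, Def. 16.5] -/
theorem exists_mem_settledT_not_isMaximal :
    ∃ 𝒟 : VacuumCauchyDevelopment trivialData, ¬ 𝒟.IsMaximal ∧ 𝒟 ∈ settledT trivialData :=
  ⟨pastCutDev, pastCutDev_not_isMaximal, pastCutDev_mem_settledT⟩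

/-- **The time truncation `{x⁰ < 1}` is NOT T-settled** (its `𝓘⁺` is incomplete; landed
`WeakCosmicCensorshipMGHD.Negative.not_hasCompleteNullInfinity_truncated`). [cite: Christodoulou1999, pp. A26–A27] -/
theorem truncated_not_mem_settledT :
    Summit.FinalStateConjecture.FinalStateConjecture.Theorems.WeakCosmicCensorshipMGHD.Negative.truncated ∉
      settledT trivialData :=
  fun h ↦ Summit.FinalStateConjecture.FinalStateConjecture.Theorems.WeakCosmicCensorshipMGHD.Negative.not_hasCompleteNullInfinity_truncated h.1

/-- **`P_T` without the maximality guard FAILS at the admissible trivial datum** (whereas with the guard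
replaced by complete `𝓘⁺` every clause holds on the flat class, `subDev_mem_settledT_iff_hasCompleteNullInfinity`):
any proof of `T` must use `𝒟.IsMaximal`, at least to exclude truncations — exactly as for the rev-1 crux
(`MaximalityLoadBearing.trivialData_exceptional_withoutIsMaximal`). [cite: Ringstrom2009, Def. 16.5] -/
theorem trivialData_exceptional_withoutIsMaximalT :
    ¬ ((∃ 𝒟 : VacuumCauchyDevelopment trivialData, 𝒟.IsMaximal) ∧
        ∀ 𝒟 : VacuumCauchyDevelopment trivialData, 𝒟 ∈ settledT trivialData) :=
  fun h ↦ truncated_not_mem_settledT (h.2 _)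

/-- What the UNGUARDED crux (guard `𝒟.IsMaximal →` deleted; a statement stronger than `T` by
monotonicity of tame genericity in the property) would demand at the trivial datum: a TAME, immersed,
injective admissible curve through it ALL of whose other members are T-settled at EVERY vacuum Cauchy
development — in particular have only complete-`𝓘⁺` developments (absurd on paper: truncate in time; not
refutable in a tree that constructs no development of a non-trivial datum). [cite: Christodoulou1999, p. A24] -/
theorem curve_obligation_of_TWithoutIsMaximal
    (h : InitialDataSet.IsTameChristodoulouGeneric (admissibleVacuumData Minkowski.slice)
      (fun D ↦ (∃ 𝒟 : VacuumCauchyDevelopment D, 𝒟.IsMaximal) ∧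
        ∀ 𝒟 : VacuumCauchyDevelopment D, 𝒟 ∈ settledT D) 1) :
    ∃ (e : AFEnd Minkowski.slice) (F : EuclideanSpace ℝ (Fin 1) → InitialDataSet (𝓡 3) Minkowski.slice),
      InitialDataSet.IsTameDataFamily e 1 F ∧ InitialDataSet.IsImmersedAtZero 1 F ∧ F 0 = trivialData ∧
        Function.Injective F ∧ (∀ c, F c ∈ admissibleVacuumData Minkowski.slice) ∧
        ∀ c, c ≠ 0 → ∀ 𝒟 : VacuumCauchyDevelopment (F c), HasCompleteNullInfinity 𝒟.toCauchyDevelopment := by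
  obtain ⟨e, F, hF, himm, h0, hinj, hmem, hE⟩ := h trivialData
    ⟨trivialData_mem_admissibleVacuumData, trivialData_exceptional_withoutIsMaximalT⟩
  refine ⟨e, F, hF, himm, h0, hinj, hmem, fun c hc 𝒟 ↦ ?_⟩
  by_contra hcon
  exact hE c hc ⟨hmem c, fun hP ↦ hcon (hP.2 𝒟).1⟩

/-- The unguarded statement is STRONGER than the crux: a refutation of `T` refutes it too (contrapositive
of monotonicity of tame genericity in the property). [cite: Christodoulou1999, p. A24] -/
theorem not_TWithoutIsMaximal_of_not_T (hn : ¬ HonestFixedRadiusSettlingT) :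
    ¬ ∀ (X : Type) [TopologicalSpace X] [ChartedSpace E3 X] [IsManifold (𝓡 3) ∞ X] [T2Space X]
      [SecondCountableTopology X] [ConnectedSpace X],
      InitialDataSet.IsTameChristodoulouGeneric (admissibleVacuumData X)
        (fun D ↦ (∃ 𝒟 : VacuumCauchyDevelopment D, 𝒟.IsMaximal) ∧
          ∀ 𝒟 : VacuumCauchyDevelopment D, 𝒟 ∈ settledT D) 1 := by
  intro h
  apply hn
  rw [T_iff]
  intro X _ _ _ _ _ _
  exact (h X).mono fun _ _ hD ↦ ⟨hD.1, fun 𝒟 _ ↦ hD.2 𝒟⟩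

end Consequences

/-! ### §3 Edit (3): the distinct-velocity conjunct -/

/-- EDIT (3) is vacuous for `N ≤ 1`; it bites only from two holes on. What it excludes for `N ≥ 2` is a pair
with equal asymptotic four-velocity and sublinearly growing separation (the structure's own
`exists_pairwise_disjoint` already excludes comoving pairs at BOUNDED separation): the parabolic threshold —
codimension `1` in every model — and the witness of the rev-2 repair of NecksCertify (`ComovingPairWitness`).
Unprovable either way in the tree. [cite: DafermosLuk2017, Conjecture 1] -/
theorem mem_velocitySet_of_N_le_one {𝓢 : Spacetime.{0} 4} {O : Set 𝓢.carrier} {k : ℕ}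
    (d : FinalStateDecomposition 𝓢 O k) (h : d.N ≤ 1) : d ∈ velocitySet 𝓢 O k := by
  haveI : Subsingleton (Fin d.N) := Fin.subsingleton_iff_le_one.2 h
  exact fun i j hij ↦ absurd (Subsingleton.elim i j) hij

end Summit.FinalStateConjecture.FinalStateConjecture.Theorems.HonestFixedRadiusSettlingT.Negative.FlatClass

end
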